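import Mathlib
import Literature.NumberTheory.Sieve.SieveFrameworkUpperBound
import Literature.NumberTheory.Sieve.PolynomialValuesSieveSequence
import Literature.NumberTheory.Sieve.PolynomialValuesSieveBounds
import Literature.NumberTheory.Sieve.IwaniecAlmostPrimesWeightedSum
import HarnessLib

/-!
# Small-cofactor tail, I: the sieve bound for `t² + 1` sifted by a window of small primes
(stub `stub_smallCofactorTail`, helper 1/3, line `cofactor-root-discrepancy`,
crux `SplitBlockJacobi`, stmt-Parity-11583)

For `μ > 0` let `W_μ(x)` be the product of the primes `p` with `2x^μ < p ≤ x^{1/40}`. We prove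
that there is an ABSOLUTE constant `C` with, for every `μ > 0`, eventually in `x`,

  `#{1 ≤ t ≤ x : (t² + 1, W_μ(x)) = 1} ≤ C · μ · x`        (`exists_card_coprime_window_le`).

Proof. The tree's upper-bound `β`-sieve for an arbitrary squarefree sifting modulus
(`SieveSequence.sifted_le_of_dvd_primesProdBelow`) applied to the polynomial sequence
`polyAPSeq (X² + 1) x 1 0` (values `t² + 1`, `1 ≤ t ≤ x`, density `ρ(m)/m` of sieve dimension `2`,
`hasSieveDimension_rootDensity`), with `z = x^{1/38}`, level `D = x^{1/2} = z^{19}` and sifting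
modulus `W ∣ P(z)`, gives `≤ (1 + 2K^{10}) · x · ∏_{p ∣ W} (1 − ρ(p)/p) + D e⁸ log² z`
(`card_coprime_prod_le`; remainders `|R_d| ≤ ρ(d)` and `∑_{d ∣ P(z), d ≤ D} ρ(d) ≤ D e⁸ log² z` are
the tree's `abs_remainder_polyAPSeq_le`, `sum_rootCount_divisors_le`). By `1 − u ≤ e^{−u}` and
Iwaniec's Mertens theorem for `ρ` (`RhoMertens_holds`: `∑_{p ≤ t} ρ(p)/p = log log t + b + o(1)`),
`∏_{2x^μ < p ≤ x^{1/40}} (1 − ρ(p)/p) ≤ e² · log(2x^μ)/log(x^{1/40}) ≤ 80 e² μ` once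
`log 2 ≤ μ log x` (`eventually_prod_window_le`); and `D e⁸ log² z ≤ e⁸ x^{21/38} ≤ μ x` eventually.
-/

noncomputable section

open Filter Finset Polynomial

namespace Summit.Parity.BatemanHorn.Cruxes.SplitBlockJacobi.CofactorRootDiscrepancy

open Literature.NumberTheory.Sieve Literature.NumberTheory.Sieve.Iwaniec1978

namespace SmallCofactor

/-! ### The `β`-sieve for `t² + 1` with an arbitrary sifting set of small primes -/

/-- `ω_{X²+1}(p) ≤ 2` at every prime `p` (the tree's `polyRootCountMod_X_sq_add_one_le_two`). -/
theorem rootCount_sq_add_one_le_two (p : ℕ) (hp : p.Prime) :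
    polyRootCountMod ![(X ^ 2 + 1 : ℤ[X])] p ≤ 2 := by
  haveI := Fact.mk hp
  exact polyRootCountMod_X_sq_add_one_le_two p

/-- `0 ≤ 1 − ρ(p)/p` for every `p` (`ρ(p) ≤ p` trivially; `p = 0` gives the junk value `1`). -/
theorem one_sub_rho_div_nonneg (p : ℕ) : 0 ≤ 1 - (rho p : ℝ) / p := by
  have h1 : rho p ≤ p := by
    unfold rho
    exact (Finset.card_filter_le _ _).trans_eq (Finset.card_range p)
  rcases Nat.eq_zero_or_pos p with rfl | hp
  · simp
  · have hp0 : (0 : ℝ) < p := by exact_mod_cast hp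
    rw [sub_nonneg, div_le_one hp0]
    exact_mod_cast h1

/-- **Upper-bound sieve for `t² + 1` with a general sifting set.** For `z ≥ 2`, `D > 1` with
`D ≥ z^{19}`, and any set `S` of primes `< z`,
`#{1 ≤ t ≤ x : (t² + 1, ∏_{p ∈ S} p) = 1} ≤ (1 + 2K^{10}) · x · ∏_{p ∈ S} (1 − ρ(p)/p)
  + D e⁸ log² z`,
`K = 2e^{17 + 12/log 2}` (the tree's `sifted_le_of_dvd_primesProdBelow` for `polyAPSeq (X²+1) x 1 0`
at height `x² + 1`, dimension `2`). -/
theorem card_coprime_prod_le {x : ℕ} {z D : ℝ} (hz : 2 ≤ z) (hD1 : 1 < D)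
    (hzD : 19 * Real.log z ≤ Real.log D) {S : Finset ℕ} (hS : S ⊆ Nat.primesBelow ⌈z⌉₊) :
    ((((Finset.Icc 1 x).filter (fun t : ℕ => (t ^ 2 + 1).Coprime (∏ p ∈ S, p))).card : ℕ) : ℝ) ≤
      (1 + 2 * (2 * Real.exp (17 + 12 / Real.log 2)) ^ 10) *
          ((x : ℝ) * ∏ p ∈ S, (1 - (rho p : ℝ) / p)) +
        D * (Real.exp 8 * Real.log z ^ 2) := by
  have h2 : polyRootCountMod ![(X ^ 2 + 1 : ℤ[X])] 2 ≤ 1 := polyRootCountMod_X_sq_add_one_two.le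
  have hle : ∀ p : ℕ, p.Prime → polyRootCountMod ![(X ^ 2 + 1 : ℤ[X])] p ≤ 2 :=
    rootCount_sq_add_one_le_two
  have hdim : HasSieveDimension (polyAPSeq (X ^ 2 + 1 : ℤ[X]) x 1 0).density 2
      (2 * Real.exp (17 + 12 / Real.log 2)) :=
    hasSieveDimension_rootDensity h2 hle
  have hx : ∀ n ∈ apIndex x 1 0, 0 < (X ^ 2 + 1 : ℤ[X]).eval (n : ℤ) ∧
      (((X ^ 2 + 1 : ℤ[X]).eval (n : ℤ) : ℤ) : ℝ) ≤ (x : ℝ) ^ 2 + 1 := by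
    intro n hn
    rw [apIndex_one, Finset.mem_Ioc] at hn
    simp only [eval_add, eval_pow, eval_X, eval_one]
    refine ⟨by positivity, ?_⟩
    have hnx : (n : ℝ) ≤ x := by exact_mod_cast hn.2
    push_cast
    nlinarith [Nat.cast_nonneg (α := ℝ) n]
  have hX : 0 ≤ (polyAPSeq (X ^ 2 + 1 : ℤ[X]) x 1 0).size ((x : ℝ) ^ 2 + 1) := by
    rw [polyAPSeq_size]; positivity
  have hSp : ∀ p ∈ S, p.Prime := fun p hp => Nat.prime_of_mem_primesBelow (hS hp)
  have hW : ∏ p ∈ S, p ∣ primesProdBelow z := Finset.prod_dvd_prod_of_subset _ _ _ hS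
  have hlogz : 0 < Real.log z := Real.log_pos (by linarith)
  have hzD' : (9 * 2 + 1) * Real.log z ≤ Real.log D := by linarith
  have hsieve := SieveSequence.sifted_le_of_dvd_primesProdBelow hdim (by norm_num) hz hD1 hzD' hX hW
  -- the sifted sum is our count
  have hsifted : (polyAPSeq (X ^ 2 + 1 : ℤ[X]) x 1 0).sifted ((x : ℝ) ^ 2 + 1) (∏ p ∈ S, p) =
      ((((Finset.Icc 1 x).filter (fun t : ℕ => (t ^ 2 + 1).Coprime (∏ p ∈ S, p))).card : ℕ) :
        ℝ) := by
    rw [polyAPSeq_sifted _ x 1 0 hx, apIndex_one]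
    congr 2
    ext n
    simp only [Finset.mem_filter, Finset.mem_Ioc, Finset.mem_Icc, eval_add, eval_pow, eval_X,
      eval_one]
    have hn : ((n : ℤ) ^ 2 + 1).natAbs = n ^ 2 + 1 := by
      rw [show ((n : ℤ) ^ 2 + 1) = ((n ^ 2 + 1 : ℕ) : ℤ) by push_cast; ring, Int.natAbs_natCast]
    rw [hn]
    constructor
    · rintro ⟨⟨h1, h2⟩, h3⟩
      exact ⟨⟨by omega, h2⟩, h3⟩
    · rintro ⟨⟨h1, h2⟩, h3⟩
      exact ⟨⟨by omega, h2⟩, h3⟩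
  -- the density product
  have hV : (polyAPSeq (X ^ 2 + 1 : ℤ[X]) x 1 0).densityProduct (∏ p ∈ S, p) =
      ∏ p ∈ S, (1 - (rho p : ℝ) / p) := by
    rw [SieveSequence.densityProduct, Nat.primeFactors_prod hSp]
    refine Finset.prod_congr rfl fun p _ => ?_
    rw [polyAPSeq_density, rootDensity_apply, rho_eq_polyRootCountMod]
  have hsize : (polyAPSeq (X ^ 2 + 1 : ℤ[X]) x 1 0).size ((x : ℝ) ^ 2 + 1) = x := by
    rw [polyAPSeq_size, Nat.cast_one, div_one]
  -- the remainder sum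
  have hrem : ∑ d ∈ (∏ p ∈ S, p).divisors.filter (fun d : ℕ => (d : ℝ) ≤ D),
      |(polyAPSeq (X ^ 2 + 1 : ℤ[X]) x 1 0).remainder d ((x : ℝ) ^ 2 + 1)| ≤
        D * (Real.exp 8 * Real.log z ^ 2) := by
    calc ∑ d ∈ (∏ p ∈ S, p).divisors.filter (fun d : ℕ => (d : ℝ) ≤ D),
          |(polyAPSeq (X ^ 2 + 1 : ℤ[X]) x 1 0).remainder d ((x : ℝ) ^ 2 + 1)|
        ≤ ∑ d ∈ (∏ p ∈ S, p).divisors.filter (fun d : ℕ => (d : ℝ) ≤ D),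
          (polyRootCountMod ![(X ^ 2 + 1 : ℤ[X])] d : ℝ) := by
          refine Finset.sum_le_sum fun d hd => ?_
          have hd0 : 0 < d := Nat.pos_of_mem_divisors (Finset.mem_filter.mp hd).1
          exact abs_remainder_polyAPSeq_le _ Nat.one_pos hd0 (Nat.coprime_one_left d) hx
      _ ≤ ∑ d ∈ (primesProdBelow z).divisors.filter (fun d : ℕ => (d : ℝ) ≤ D),
          (polyRootCountMod ![(X ^ 2 + 1 : ℤ[X])] d : ℝ) :=
          Finset.sum_le_sum_of_subset_of_nonneg
            (Finset.filter_subset_filter _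
              (Nat.divisors_subset_of_dvd (primesProdBelow_ne_zero z) hW))
            fun _ _ _ => Nat.cast_nonneg _
      _ ≤ D * (Real.exp 8 * Real.log z ^ 2) := sum_rootCount_divisors_le hle hz (by linarith)
  -- the main-term factor
  have hexp : Real.exp ((9 * 2 + 1) - Real.log D / Real.log z) ≤ 1 := by
    rw [Real.exp_le_one_iff, sub_nonpos, le_div_iff₀ hlogz]
    linarith
  have hVnn : 0 ≤ (x : ℝ) * ∏ p ∈ S, (1 - (rho p : ℝ) / p) :=
    mul_nonneg (Nat.cast_nonneg _) (Finset.prod_nonneg fun p _ => one_sub_rho_div_nonneg p)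
  have hfac : 1 + 2 * (2 * Real.exp (17 + 12 / Real.log 2)) ^ 10 *
      Real.exp ((9 * 2 + 1) - Real.log D / Real.log z) ≤
        1 + 2 * (2 * Real.exp (17 + 12 / Real.log 2)) ^ 10 := by
    have hK0 : (0 : ℝ) ≤ 2 * (2 * Real.exp (17 + 12 / Real.log 2)) ^ 10 := by positivity
    nlinarith
  rw [hsifted, hV, hsize] at hsieve
  exact hsieve.trans (add_le_add (mul_le_mul_of_nonneg_right hfac hVnn) hrem)

/-! ### The Mertens bound for the window product -/

/-- `∏_{p ∈ S} (1 − ρ(p)/p) ≤ exp(−∑_{p ∈ S} ρ(p)/p)` (`1 − u ≤ e^{−u}`, all factors `≥ 0`). -/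
theorem prod_one_sub_rho_le_exp (S : Finset ℕ) :
    ∏ p ∈ S, (1 - (rho p : ℝ) / p) ≤ Real.exp (-∑ p ∈ S, (rho p : ℝ) / p) := by
  rw [← Finset.sum_neg_distrib, Real.exp_sum]
  refine Finset.prod_le_prod (fun p _ => one_sub_rho_div_nonneg p) fun p _ => ?_
  have := Real.add_one_le_exp (-((rho p : ℝ) / p))
  linarith

/-- The window sum dominates the difference of the partial sums, with no order between the
endpoints: `F(t₂) − F(t₁) ≤ ∑_{p ≤ t₂, p > t₁} ρ(p)/p`, `F(t) = ∑_{p ≤ t} ρ(p)/p`. -/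
theorem sub_le_sum_window (t₁ t₂ : ℝ) :
    (∑ p ∈ Nat.primesLE ⌊t₂⌋₊, (rho p : ℝ) / p) - ∑ p ∈ Nat.primesLE ⌊t₁⌋₊, (rho p : ℝ) / p ≤
      ∑ p ∈ Nat.primesLE ⌊t₂⌋₊ \ Nat.primesLE ⌊t₁⌋₊, (rho p : ℝ) / p := by
  have h := Finset.sum_inter_add_sum_sdiff (Nat.primesLE ⌊t₂⌋₊) (Nat.primesLE ⌊t₁⌋₊)
    (fun p : ℕ => (rho p : ℝ) / p)
  have hle : ∑ p ∈ Nat.primesLE ⌊t₂⌋₊ ∩ Nat.primesLE ⌊t₁⌋₊, (rho p : ℝ) / p ≤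
      ∑ p ∈ Nat.primesLE ⌊t₁⌋₊, (rho p : ℝ) / p :=
    Finset.sum_le_sum_of_subset_of_nonneg Finset.inter_subset_right fun _ _ _ => by positivity
  linarith

/-- **Mertens for `ρ` over the window `(2x^μ, x^{1/40}]`:** for `μ > 0`, eventually in `x`,
`∏_{2x^μ < p ≤ x^{1/40}} (1 − ρ(p)/p) ≤ 80 e² μ`. From `RhoMertens_holds`
(`|∑_{p ≤ t} ρ(p)/p − log log t − b| < 1` for `t ≥ T₀`): the window sum is
`≥ log log x^{1/40} − log log (2x^μ) − 2`, and `log(2x^μ) ≤ 2μ log x` once `log 2 ≤ μ log x`. -/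
theorem eventually_prod_window_le {μ : ℝ} (hμ : 0 < μ) :
    ∀ᶠ x : ℕ in atTop,
      ∏ p ∈ Nat.primesLE ⌊(x : ℝ) ^ (1 / 40 : ℝ)⌋₊ \ Nat.primesLE ⌊2 * (x : ℝ) ^ μ⌋₊,
          (1 - (rho p : ℝ) / p) ≤ 80 * Real.exp 2 * μ := by
  obtain ⟨b, hb⟩ := RhoMertens_holds
  obtain ⟨T₀, hT₀⟩ := Metric.tendsto_atTop.mp hb 1 one_pos
  have ev1 : ∀ᶠ x : ℕ in atTop, T₀ ≤ (x : ℝ) ^ (1 / 40 : ℝ) :=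
    ((tendsto_rpow_atTop (by norm_num)).comp tendsto_natCast_atTop_atTop).eventually_ge_atTop T₀
  have ev2 : ∀ᶠ x : ℕ in atTop, T₀ ≤ 2 * (x : ℝ) ^ μ :=
    (((tendsto_rpow_atTop hμ).comp tendsto_natCast_atTop_atTop).const_mul_atTop
      two_pos).eventually_ge_atTop T₀
  have ev3 : ∀ᶠ x : ℕ in atTop, Real.log 2 ≤ μ * Real.log x :=
    ((Real.tendsto_log_atTop.comp tendsto_natCast_atTop_atTop).const_mul_atTop
      hμ).eventually_ge_atTop _
  have ev4 : ∀ᶠ x : ℕ in atTop, 2 ≤ x := eventually_ge_atTop 2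
  filter_upwards [ev1, ev2, ev3, ev4] with x h1 h2 h3 h4
  have hx1 : (1 : ℝ) < x := by exact_mod_cast h4
  have hx0 : (0 : ℝ) < x := by linarith
  have hlogx : 0 < Real.log x := Real.log_pos hx1
  have hxμ : 0 < (x : ℝ) ^ μ := Real.rpow_pos_of_pos hx0 μ
  have hlt2 : Real.log ((x : ℝ) ^ (1 / 40 : ℝ)) = 1 / 40 * Real.log x := Real.log_rpow hx0 _
  have hlt1 : Real.log (2 * (x : ℝ) ^ μ) = Real.log 2 + μ * Real.log x := by
    rw [Real.log_mul two_ne_zero hxμ.ne', Real.log_rpow hx0]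
  have hlt2pos : 0 < Real.log ((x : ℝ) ^ (1 / 40 : ℝ)) := by rw [hlt2]; positivity
  have hlog2 : 0 < Real.log 2 := Real.log_pos one_lt_two
  have hlt1pos : 0 < Real.log (2 * (x : ℝ) ^ μ) := by rw [hlt1]; positivity
  have hlt1le : Real.log (2 * (x : ℝ) ^ μ) ≤ 2 * μ * Real.log x := by rw [hlt1]; linarith
  -- Mertens at the two endpoints
  have F2 := hT₀ _ h1
  have F1 := hT₀ _ h2
  rw [Real.dist_eq] at F1 F2
  have key : -(∑ p ∈ Nat.primesLE ⌊(x : ℝ) ^ (1 / 40 : ℝ)⌋₊ \ Nat.primesLE ⌊2 * (x : ℝ) ^ μ⌋₊,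
      (rho p : ℝ) / p) ≤ Real.log (Real.log (2 * (x : ℝ) ^ μ)) -
        Real.log (Real.log ((x : ℝ) ^ (1 / 40 : ℝ))) + 2 := by
    have hsd := sub_le_sum_window (2 * (x : ℝ) ^ μ) ((x : ℝ) ^ (1 / 40 : ℝ))
    have a2 := (abs_lt.mp F2).1
    have a1 := (abs_lt.mp F1).2
    linarith
  calc ∏ p ∈ Nat.primesLE ⌊(x : ℝ) ^ (1 / 40 : ℝ)⌋₊ \ Nat.primesLE ⌊2 * (x : ℝ) ^ μ⌋₊,
        (1 - (rho p : ℝ) / p)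
      ≤ Real.exp (-∑ p ∈ Nat.primesLE ⌊(x : ℝ) ^ (1 / 40 : ℝ)⌋₊ \ Nat.primesLE ⌊2 * (x : ℝ) ^ μ⌋₊,
          (rho p : ℝ) / p) := prod_one_sub_rho_le_exp _
    _ ≤ Real.exp (Real.log (Real.log (2 * (x : ℝ) ^ μ)) -
          Real.log (Real.log ((x : ℝ) ^ (1 / 40 : ℝ))) + 2) := Real.exp_le_exp.mpr key
    _ = Real.log (2 * (x : ℝ) ^ μ) / Real.log ((x : ℝ) ^ (1 / 40 : ℝ)) * Real.exp 2 := by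
        rw [Real.exp_add, Real.exp_sub, Real.exp_log hlt1pos, Real.exp_log hlt2pos]
    _ ≤ 80 * μ * Real.exp 2 := by
        refine mul_le_mul_of_nonneg_right ?_ (Real.exp_pos 2).le
        rw [div_le_iff₀ hlt2pos, hlt2]
        nlinarith
    _ = 80 * Real.exp 2 * μ := by ring

end SmallCofactor

/-! ### The sieve bound for the window (registered sub-goal of `stub_smallCofactorTail`) -/

/-- **The window-sifted count of `t² + 1` is `O(μ x)`:** there is an absolute `C > 0` such that
for every `μ > 0`, eventually in `x`,
`#{1 ≤ t ≤ x : (t² + 1, ∏_{2x^μ < p ≤ x^{1/40}} p) = 1} ≤ C μ x`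
(`card_coprime_prod_le` with `z = x^{1/38}`, `D = x^{1/2}`, `eventually_prod_window_le`, and
`D e⁸ log² z ≤ e⁸ x^{21/38} ≤ μ x`). -/
theorem exists_card_coprime_window_le :
    ∃ C : ℝ, 0 < C ∧ ∀ μ : ℝ, 0 < μ → ∀ᶠ x : ℕ in Filter.atTop,
      ((((Finset.Icc 1 x).filter (fun t : ℕ => (t ^ 2 + 1).Coprime
          (∏ p ∈ Nat.primesLE ⌊(x : ℝ) ^ (1 / 40 : ℝ)⌋₊ \ Nat.primesLE ⌊2 * (x : ℝ) ^ μ⌋₊,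
            p))).card : ℕ) : ℝ) ≤ C * μ * x := by
  refine ⟨(1 + 2 * (2 * Real.exp (17 + 12 / Real.log 2)) ^ 10) * (80 * Real.exp 2) + 1,
    by positivity, fun μ hμ => ?_⟩
  have evV := SmallCofactor.eventually_prod_window_le hμ
  have evz : ∀ᶠ x : ℕ in atTop, 2 ≤ (x : ℝ) ^ (1 / 38 : ℝ) :=
    ((tendsto_rpow_atTop (by norm_num)).comp tendsto_natCast_atTop_atTop).eventually_ge_atTop 2
  have evr : ∀ᶠ x : ℕ in atTop, Real.exp 8 / μ ≤ (x : ℝ) ^ (17 / 38 : ℝ) :=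
    ((tendsto_rpow_atTop (by norm_num)).comp tendsto_natCast_atTop_atTop).eventually_ge_atTop _
  have ev2 : ∀ᶠ x : ℕ in atTop, 2 ≤ x := eventually_ge_atTop 2
  filter_upwards [evV, evz, evr, ev2] with x hV hz hr hx2
  have hx1 : (1 : ℝ) < x := by exact_mod_cast hx2
  have hx0 : (0 : ℝ) < x := by linarith
  have hlogx : 0 < Real.log x := Real.log_pos hx1
  have hlogz : Real.log ((x : ℝ) ^ (1 / 38 : ℝ)) = 1 / 38 * Real.log x := Real.log_rpow hx0 _
  have hlogD : Real.log ((x : ℝ) ^ (1 / 2 : ℝ)) = 1 / 2 * Real.log x := Real.log_rpow hx0 _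
  have hD1 : 1 < (x : ℝ) ^ (1 / 2 : ℝ) := Real.one_lt_rpow hx1 (by norm_num)
  have hzD : 19 * Real.log ((x : ℝ) ^ (1 / 38 : ℝ)) ≤ Real.log ((x : ℝ) ^ (1 / 2 : ℝ)) := by
    rw [hlogz, hlogD]; linarith
  have hS : Nat.primesLE ⌊(x : ℝ) ^ (1 / 40 : ℝ)⌋₊ \ Nat.primesLE ⌊2 * (x : ℝ) ^ μ⌋₊ ⊆
      Nat.primesBelow ⌈(x : ℝ) ^ (1 / 38 : ℝ)⌉₊ := by
    intro p hp
    rw [Finset.mem_sdiff, Nat.mem_primesLE] at hp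
    rw [Nat.mem_primesBelow]
    refine ⟨Nat.lt_ceil.mpr ?_, hp.1.2⟩
    have h1 : (p : ℝ) ≤ ⌊(x : ℝ) ^ (1 / 40 : ℝ)⌋₊ := by exact_mod_cast hp.1.1
    have h2 : (⌊(x : ℝ) ^ (1 / 40 : ℝ)⌋₊ : ℝ) ≤ (x : ℝ) ^ (1 / 40 : ℝ) :=
      Nat.floor_le (by positivity)
    have h3 : (x : ℝ) ^ (1 / 40 : ℝ) < (x : ℝ) ^ (1 / 38 : ℝ) :=
      Real.rpow_lt_rpow_of_exponent_lt hx1 (by norm_num)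
    linarith
  have hsieve := SmallCofactor.card_coprime_prod_le (x := x) hz hD1 hzD hS
  -- the remainder is `≤ μ x`
  have hrem : (x : ℝ) ^ (1 / 2 : ℝ) * (Real.exp 8 * Real.log ((x : ℝ) ^ (1 / 38 : ℝ)) ^ 2) ≤
      μ * x := by
    have hzpos : 0 < (x : ℝ) ^ (1 / 38 : ℝ) := by positivity
    have hlz : Real.log ((x : ℝ) ^ (1 / 38 : ℝ)) ≤ (x : ℝ) ^ (1 / 38 : ℝ) :=
      (Real.log_le_sub_one_of_pos hzpos).trans (by linarith)
    have hlz0 : 0 ≤ Real.log ((x : ℝ) ^ (1 / 38 : ℝ)) := by rw [hlogz]; positivity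
    have hsq : Real.log ((x : ℝ) ^ (1 / 38 : ℝ)) ^ 2 ≤ ((x : ℝ) ^ (1 / 38 : ℝ)) ^ 2 :=
      pow_le_pow_left₀ hlz0 hlz 2
    have hz2 : ((x : ℝ) ^ (1 / 38 : ℝ)) ^ 2 = (x : ℝ) ^ (1 / 19 : ℝ) := by
      rw [← Real.rpow_natCast, ← Real.rpow_mul hx0.le]; norm_num
    have hDz : (x : ℝ) ^ (1 / 2 : ℝ) * (x : ℝ) ^ (1 / 19 : ℝ) = (x : ℝ) ^ (21 / 38 : ℝ) := by
      rw [← Real.rpow_add hx0]; norm_num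
    have hxx : (x : ℝ) ^ (17 / 38 : ℝ) * (x : ℝ) ^ (21 / 38 : ℝ) = x := by
      rw [← Real.rpow_add hx0]; norm_num
    have h8 : Real.exp 8 ≤ μ * (x : ℝ) ^ (17 / 38 : ℝ) := by
      rw [div_le_iff₀ hμ] at hr; linarith
    calc (x : ℝ) ^ (1 / 2 : ℝ) * (Real.exp 8 * Real.log ((x : ℝ) ^ (1 / 38 : ℝ)) ^ 2)
        ≤ (x : ℝ) ^ (1 / 2 : ℝ) * (Real.exp 8 * ((x : ℝ) ^ (1 / 38 : ℝ)) ^ 2) := by gcongr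
      _ = Real.exp 8 * ((x : ℝ) ^ (1 / 2 : ℝ) * (x : ℝ) ^ (1 / 19 : ℝ)) := by rw [hz2]; ring
      _ = Real.exp 8 * (x : ℝ) ^ (21 / 38 : ℝ) := by rw [hDz]
      _ ≤ μ * (x : ℝ) ^ (17 / 38 : ℝ) * (x : ℝ) ^ (21 / 38 : ℝ) :=
          mul_le_mul_of_nonneg_right h8 (by positivity)
      _ = μ * x := by rw [mul_assoc, hxx]
  -- the main term is `≤ (1 + 2K^{10}) · x · 80e²μ`
  have hK0 : (0 : ℝ) ≤ 1 + 2 * (2 * Real.exp (17 + 12 / Real.log 2)) ^ 10 := by positivity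
  have hmain : (1 + 2 * (2 * Real.exp (17 + 12 / Real.log 2)) ^ 10) *
      ((x : ℝ) * ∏ p ∈ Nat.primesLE ⌊(x : ℝ) ^ (1 / 40 : ℝ)⌋₊ \ Nat.primesLE ⌊2 * (x : ℝ) ^ μ⌋₊,
        (1 - (rho p : ℝ) / p)) ≤
      (1 + 2 * (2 * Real.exp (17 + 12 / Real.log 2)) ^ 10) * ((x : ℝ) * (80 * Real.exp 2 * μ)) :=
    mul_le_mul_of_nonneg_left (mul_le_mul_of_nonneg_left hV hx0.le) hK0
  calc _ ≤ _ := hsieve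
    _ ≤ (1 + 2 * (2 * Real.exp (17 + 12 / Real.log 2)) ^ 10) * ((x : ℝ) * (80 * Real.exp 2 * μ)) +
          μ * x := add_le_add hmain hrem
    _ = ((1 + 2 * (2 * Real.exp (17 + 12 / Real.log 2)) ^ 10) * (80 * Real.exp 2) + 1) * μ * x := by
        ring

end Summit.Parity.BatemanHorn.Cruxes.SplitBlockJacobi.CofactorRootDiscrepancy

end
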